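import Summits.BirchSwinnertonDyer.BirchSwinnertonDyer.Theses.BiquadraticEisensteinDescent
import Literature.NumberTheory.CubicFields.HasseThreeTorsionDictionary
import Literature.NumberTheory.CubicFields.IndexPSubringCount

/-!
# Sketch — crux idea `splitting-bias` (seat 1, g28) for `HeegnerTwistCouplingInSupply` (stmt-21381)

First-lemma signatures only (CRUX-IDEATE: no skeleton, nothing proved, not registered). BSD is not
proved by any of this. Namespace per protocol.
-/

namespace Summit.BirchSwinnertonDyer.BirchSwinnertonDyer.Cruxes.HeegnerTwistCouplingInSupply.SplittingBias

open Literature.NumberTheory.EllipticCurves Literature.NumberTheory.QuadraticFields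
open Literature.NumberTheory.CubicFields

/-- The Sylvester corner curve `W_p : y² + p·y = x³` (≅ `y² = x³ + 16p²`; `j = 0`, CM by `ℤ[ζ₃]`, type IV
at `p`, conductor `27p²`; for `p ≡ 8 (mod 9)`: CM-inert, root number `−1`, `¬ Good W p`). -/
def sylvesterCurve (p : ℕ) : WeierstrassCurve ℚ := ⟨0, 0, (p : ℚ), 0, 0⟩

/-- The Heegner window `𝒟_X(p)`: negative fundamental `D`, `|D| < X`, `D < −4`, `D ≡ 1 (mod 3)`
(`3` splits) and `(D/p) = +1` (`p` splits) — the Heegner fields of level `27p²`. -/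
noncomputable def heegnerWindow (p X : ℕ) : Finset ℤ :=
  (negFundDiscrs X).filter fun D => D % 3 = 1 ∧ jacobiSym D p = 1 ∧ D < -4

/-- `UnitIsCubeMod L p`: every unit of `𝓞 L` is a cube modulo `p·𝓞 L`.  For `L = ℚ(√(−3D))` real
quadratic with `p` inert: "the fundamental unit `ε_{−3D}` is a cube in `(𝓞_L/p)ˣ ≅ 𝔽_{p²}ˣ`". -/
def UnitIsCubeMod (L : Type) [Field L] [NumberField L] (p : ℕ) : Prop :=
  ∀ u : (NumberField.RingOfIntegers L)ˣ, ∃ x : NumberField.RingOfIntegers L,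
    ((u : NumberField.RingOfIntegers L) - x ^ 3) ∈ Ideal.span {(p : NumberField.RingOfIntegers L)}

/-- **L1 · `SylvesterCornerCertificate` (same-field 3-descent; the L-side is DECIDED by class-group /
unit data of discriminants `D` and `−3D`, no coupling).**  For `p ≡ 8 (mod 9)` and a Heegner field
`K = ℚ(√D)` of level `27p²` (`D < −4`, `D ≡ 1 (mod 3)`): if `3 ∤ h(D)` and the fundamental unit of
`ℚ(√(−3D))` is NOT a cube modulo the inert prime `p`, then `Sel₃(W_p^{(D)}/ℚ) = 0`, hence (Burungale–Tian
rank-0 `p`-converse for CM curves at the prime 3, `burungaleTian_analyticRank_eq_zero_of_selmerCorank_eq_zero_of_hasCM`)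
`L(W_p^{(D)}, 1) ≠ 0`.  [3-isogeny `φ : W^{(D)} → W'^{(D)}`, `ker φ ≅ 𝔽₃(χ_D)`, `ker φ̂ ≅ 𝔽₃(χ_{−3D})`;
Tamagawa ratio `c_p(E')/c_p(E) = 1/3`, `c_3(E')/c_3(E) = 3` (types IV*, II / IV, IV*), Selmer ratio 1;
`Sel^φ ⊂ Hom(Cl_{(9)}(ℚ(√D)), ℤ/3)⁻ ⊕ 0`, `Sel^{φ̂} ⊂ ⟨κ_p⟩` with `κ_p` the order-3 character of conductor
`p` of `ℚ(√(−3D))`, which exists iff `ε_{−3D}` is a cube mod `p`.]  Falsifier run: kit j330730/j330880 Part A. -/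
def SylvesterCornerCertificate : Prop :=
  ∀ (p : ℕ) [Fact p.Prime], p % 9 = 8 →
  ∀ (K : Type) [Field K] [NumberField K], IsImaginaryQuadratic K →
    4 < (NumberField.discr K).natAbs → NumberField.discr K % 3 = 1 →
    SatisfiesHeegnerHypothesis (27 * p ^ 2) K →
    ¬ 3 ∣ NumberField.classNumber K →
    (∀ (L : Type) [Field L] [NumberField L], Module.finrank ℚ L = 2 →
        NumberField.discr L = -3 * NumberField.discr K → ¬ UnitIsCubeMod L p) →
    ((sylvesterCurve p).quadraticTwist (NumberField.discr K : ℚ)).entireLFunction 1 ≠ 0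

/-- **L2 · `PsiTwistedCubicFieldCountBurgess` (residual E-ψ: "Davenport–Heilbronn in the Burgess
range").**  The number of cubic fields (`a = 1`: discriminant `D`; `a = 81`: the conductor-9 fields with
quadratic resolvent `ℚ(√D)`) is asymptotically the same over `D` with `(D/p) = +1` and `(D/p) = −1`, with a
POWER saving, as soon as `X ≥ p^{2−η}` — below the Pólya–Vinogradov / convexity range `X ≫ p^{2+ε}` of
Taniguchi–Thorne Cor. 12 / Bhargava–Taniguchi–Thorne Thm 1.3.  Route: Bhargava averaging over boxes of
side `X^{1/4} ≥ p^{2/5+ε}` + Pierce–Xu stratified multiplicative Burgess for `ψ_p ∘ Disc` on `Sym³`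
(`n = 4`, `Disc` is `(2,p)`-admissible) + Davenport–Heilbronn maximality sieve. -/
def PsiTwistedCubicFieldCountBurgess : Prop :=
  ∃ η : ℝ, 0 < η ∧ ∃ C : ℝ, ∀ a : ℤ, (a = 1 ∨ a = 81) → ∀ p : ℕ, p.Prime → 5 ≤ p →
    ∀ X : ℕ, (p : ℝ) ^ (2 - η) ≤ X →
      |∑ D ∈ (negFundDiscrs X).filter (fun D => D % 3 = 1),
          (jacobiSym D p : ℝ) * (cubicFieldCountOfDisc (a * D) : ℝ)| ≤ C * (X : ℝ) * (p : ℝ) ^ (-η)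

/-- The number of degree-one primes of `K` above `p` (`N_p(K) = #{𝔭 | p : f(𝔭|p) = 1}`; for a cubic
field and `p ∤ D_K`: `3, 1, 0` for the splitting types `(111), (12), (3)`; `= λ_K(p) + 1` with `λ_K(p)` the
`p`-th coefficient of the Artin L-function `ζ_K/ζ`). -/
noncomputable def degOnePrimes (K : Type) [Field K] [NumberField K] (p : ℕ) : ℕ :=
  Nat.card {P : Ideal (NumberField.RingOfIntegers K) //
    P ∈ (Ideal.span {(p : ℤ)}).primesOver (NumberField.RingOfIntegers K) ∧
      P.inertiaDeg ℤ = 1}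

/-- **L3 · `RootCountFirstMoment` (residual E-N: first moment of `N_p` over conductor-9 cubic fields,
level of distribution `X ≥ p^{1+ε}`).**  `Σ_{D} Σ_{K : D_K = 81D} (N_p(K) − 1)` is small: main term `O(X/p)`
(Chebotarev densities `1/6·3 + 1/2·1 + 1/3·0 = 1` up to `O(1/p)`), error `X^{1−κ} p^{κ}`.  Route: `N_p(x) =
#{P ∈ ℙ¹(𝔽_p) : x(P) = 0}` is LINEAR in hyperplane-lattice indicators (`L_P = {x : x(P) ≡ 0 (p)}`, covolume
`p`, cf. `RingOfForm.zeroLines` / BTT Lemma 2.3), so the count is `Σ_P #(𝓕_X ∩ L_P)`: Davenport /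
Barroero–Widmer per lattice, successive-minima bookkeeping over `P`, cusp cut at `t ≈ X^{1/12}p^{−1/12}`,
maximality sieve as in Bhargava–Shankar–Tsimerman. -/
def RootCountFirstMoment : Prop :=
  ∃ κ : ℝ, 0 < κ ∧ ∃ C : ℝ, ∀ p : ℕ, p.Prime → 5 ≤ p → ∀ X : ℕ, (p : ℝ) ≤ X →
    |∑ D ∈ (negFundDiscrs X).filter (fun D => D % 3 = 1),
        ∑ᶠ K : cubicSubfieldsOfDisc (81 * D), ((degOnePrimes K.1 p : ℝ) - 1)|
      ≤ C * ((X : ℝ) / p + (X : ℝ) ^ (1 - κ) * (p : ℝ) ^ κ)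

/-- **L4 · `ClassNumberFirstMomentUpper` (classical size input, Gauss–Lipschitz–Vinogradov mean value;
only the upper bound is used).** -/
def ClassNumberFirstMomentUpper : Prop :=
  ∃ C : ℝ, ∀ X : ℕ, (∑ D ∈ negFundDiscrs X, (BinaryQuadraticForm.classNumber D : ℝ)) ≤ C * (X : ℝ) ^ (3 / 2 : ℝ)

/-- **The corner conclusion the four lemmas assemble to** (the crux `HeegnerTwistCouplingInSupply`
specialised to `W = W_p`, `p ≡ 8 (mod 9)`, `p ≥ p₀`; its supply hypothesis is not even used): a Heegner
field of level `27p²` with `L(W_p^{(D)},1) ≠ 0` and `p ∤ h(D)` — in fact `h(D) < p`. -/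
def SylvesterCornerConclusion : Prop :=
  ∃ p₀ : ℕ, ∀ (p : ℕ) [Fact p.Prime], p₀ ≤ p → p % 9 = 8 →
    ∃ (K : Type) (_ : Field K) (_ : NumberField K), IsImaginaryQuadratic K ∧
      4 < (NumberField.discr K).natAbs ∧
      SatisfiesHeegnerHypothesis (27 * p ^ 2) K ∧
      ((sylvesterCurve p).quadraticTwist (NumberField.discr K : ℚ)).entireLFunction 1 ≠ 0 ∧
      NumberField.classNumber K < p

/-- Shape of the line (NOT a registered skeleton; W-79): certificate + two counting lemmas + size. -/
def LineShape : Prop :=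
  SylvesterCornerCertificate → PsiTwistedCubicFieldCountBurgess → RootCountFirstMoment →
    ClassNumberFirstMomentUpper → SylvesterCornerConclusion

#check @burungaleTian_analyticRank_eq_zero_of_selmerCorank_eq_zero_of_hasCM
#check @Literature.NumberTheory.CubicFields.Hasse1930_threeTorsion_dictionary_neg
#check @Literature.NumberTheory.CubicFields.cubicFieldCountOfDisc
#check @Literature.NumberTheory.CubicFields.RingOfForm.zeroLines
#check @Summit.BirchSwinnertonDyer.BirchSwinnertonDyer.Theses.BiquadraticEisensteinDescent.HeegnerTwistCouplingInSupply

end Summit.BirchSwinnertonDyer.BirchSwinnertonDyer.Cruxes.HeegnerTwistCouplingInSupply.SplittingBias
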